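import Literature.Geometry.Riemannian.ThreeShrinkerClassification
import Literature.Geometry.Riemannian.ConstantCurvatureRicci
import Literature.Geometry.Riemannian.PerelmanEntropyCutoff
import Literature.Geometry.Lorentzian.HessianLocalMax
import Literature.Geometry.Lorentzian.EinsteinProofs
import HarnessLib

/-!
# Compact Einstein gradient shrinkers have constant potential; the space-form data `R ≡ φ ≡ 3/2`

Third companion of `ThreeShrinkerClassification.lean` (named fact
`Literature.Geometry.Riemannian.threeShrinkerClassification_modelData`: the classification of
complete three-dimensional gradient shrinking Ricci solitons, Munteanu–Wang arXiv:1606.01861,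
Thm. 1.2, exported as the model data of a normalised shrinker). This file PROVES the potential
part of derivation (a) of that fact's docstring — the step from the geometric classification of
the compact case ("`(N, h) ≅ S³(r)/Γ`", Ivey 1993, Thm. 1: a compact three-dimensional shrinking
soliton has constant sectional curvature) to the model data `R ≡ 3/2`, `φ ≡ 3/2`:

> "`Ric = (2/r²) h`, so `Hess φ = (½ − 2/r²) h` for the smooth `φ` on the closed manifold `N`,
> which at a maximum and at a minimum point of `φ` forces `r = 2`, whence … `φ` is constant;
> `R = 6/r² = 3/2`, `|∇φ| = 0`, and the normalisation gives `φ ≡ 3/2`."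

in two layers, both for the raw clauses of the fact's binder (`Ric + Hess φ = ½ h`,
`R + |∇φ|² = φ`):

* `einsteinShrinker_const_of_compactSpace` — **any dimension, any model**: on a compact connected
  Riemannian manifold of positive dimension `m`, if `Ric = λ h` (Einstein) and `(h, φ)` is a
  normalised gradient shrinker, then `λ = ½`, `R ≡ m/2` and `φ ≡ m/2`. Proof as printed: the
  soliton equation gives `Hess φ (v, v) = (½ − λ) h(v, v)`; at a maximum point of `φ` the
  covariant Hessian is `≤ 0` (`hessian_apply_self_nonpos_of_isLocalMax`, O'Neill 1983, Ch. 3,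
  Lemma 3.49) and at a minimum point `≥ 0`, so `λ = ½`; then `R = tr_h (λ h) = m/2`, and
  `φ = R + |∇φ|² ≥ m/2` with equality at the maximum point of `φ`, where `dφ = 0` (Fermat,
  `mvfderiv_eq_zero_of_isMaxOn`). (Eminenti–La Nave–Mantegazza 2008, §1: compact Einstein
  shrinking solitons have constant potential; Carrillo–Ni 2009, Rem. 4.2.)
* `constantCurvatureShrinker_three_of_compactSpace` — **dimension three, constant curvature**: in
  the binder of `threeShrinkerClassification_modelData` with `N` compact, if `h` has constant
  sectional curvature `K` then `K = ¼`, `R ≡ 3/2` and `φ ≡ 3/2` (`Ric = 2K h` by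
  `HasConstantSectionalCurvatureWith.ricci_eq_smul_of_isRiemannian`, Lee 2018, Prop. 8.36), i.e.
  the first three clauses of disjunct (a) of the fact
  (`modelData_a_potential_of_constantCurvature`).

What is NOT here: the volume clause `Vol(N) = 16π²/k` of (a) (Killing–Hopf is in the tree,
`KillingHopf.exists_orthogonal_quotient`; the volume of the round `S³` and the multiplicativity
of volume under finite Riemannian coverings are not yet), and Ivey's theorem itself.
Everything is proved; no definitions, no named facts (D-0026).

## References

* O. Munteanu, J. Wang, *Structure at infinity for shrinking Ricci solitons*, arXiv:1606.01861,
  Thm. 1.2 (p. 3) and the proof of Thm. 5.1 (p. 21). [MunteanuWang2016]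
* T. Ivey, *Ricci solitons on compact three-manifolds*, Diff. Geom. Appl. 3 (1993), Thm. 1.
  [Ivey1993]
* M. Eminenti, G. La Nave, C. Mantegazza, *Ricci solitons: the equation point of view*,
  Manuscripta Math. 127 (2008), §1. [EminentiLaNaveMantegazza2008]
* J. A. Carrillo, L. Ni, Comm. Anal. Geom. 17 (2009), Rem. 4.2. [CarrilloNi2009]
* B. O'Neill, *Semi-Riemannian geometry* (1983), Ch. 3, Lemma 3.49. [ONeill1983]
* J. M. Lee, *Introduction to Riemannian Manifolds*, 2nd ed. (2018), Prop. 8.36. [Lee2018]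
-/

noncomputable section

open Bundle Set Function Filter Module
open scoped Manifold ContDiff Topology

namespace Literature.Geometry.Riemannian

open Lorentzian Lorentzian.PseudoRiemannianMetric

/-! ### Compact Einstein normalised shrinkers: `λ = ½`, `R ≡ φ ≡ m/2` -/

section Einstein

variable {E : Type*} [NormedAddCommGroup E] [NormedSpace ℝ E] [FiniteDimensional ℝ E]
  [CompleteSpace E] {H : Type*} [TopologicalSpace H] {I : ModelWithCorners ℝ E H} [I.Boundaryless]
  {M : Type*} [TopologicalSpace M] [ChartedSpace H M] [IsManifold I ∞ M]
  (g : PseudoRiemannianMetric I ∞ E (TangentSpace I : M → Type _)) [g.HasLeviCivita]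

omit [FiniteDimensional ℝ E] [CompleteSpace E] [I.Boundaryless] in
/-- On a gradient shrinker `Ric + Hess φ = ½ h` which is Einstein, `Ric = λ h`, the Hessian of the
potential is `Hess φ (X, Y) = (½ − λ) h(X, Y)`.
[cite: MunteanuWang2016, proof of Thm 5.1 (p. 21)] -/
theorem hessian_eq_of_einsteinShrinker {f : M → ℝ} {lam : ℝ}
    (hRic : ∀ (x : M) (X Y : TangentSpace I x), g.ricci x X Y = lam * g.val x X Y)
    (hsol : ∀ (x : M) (X Y : TangentSpace I x),
      g.ricci x X Y + g.hessian f x X Y = (1 / 2 : ℝ) * g.val x X Y)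
    (x : M) (X Y : TangentSpace I x) :
    g.hessian f x X Y = (1 / 2 - lam) * g.val x X Y := by
  have h := hsol x X Y
  rw [hRic x X Y] at h
  linarith

omit [CompleteSpace E] [I.Boundaryless] in
/-- The scalar curvature of an Einstein metric `Ric = λ h` on a manifold of dimension `m` is
`R = λ m` (`tr_h h = m`, `trace_toBilinForm_eq`). [folklore] -/
theorem scalarCurvature_eq_of_ricci_eq_smul {lam : ℝ}
    (hRic : ∀ (x : M) (X Y : TangentSpace I x), g.ricci x X Y = lam * g.val x X Y) (x : M) :
    g.scalarCurvature x = lam * finrank ℝ E := by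
  have hform : g.ricci x = lam • g.toBilinForm x := by
    refine LinearMap.ext₂ fun X Y ↦ ?_
    simpa using hRic x X Y
  rw [PseudoRiemannianMetric.scalarCurvature, hform, trace_smul, trace_toBilinForm_eq]

/-- **Compact Einstein normalised gradient shrinkers have `λ = ½` and constant potential
`φ ≡ R ≡ m/2`.** Let `(M, h)` be a compact connected Riemannian manifold of dimension `m ≥ 1`
(model with no boundary), `φ` smooth, with `Ric = λ h`, `Ric + Hess φ = ½ h` and `R + |∇φ|² = φ`.
Then `λ = ½`, `R ≡ m/2` and `φ ≡ m/2`. As printed (Munteanu–Wang 2016, proof of Thm. 5.1 /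
docstring of `threeShrinkerClassification_modelData`, derivation (a)): `Hess φ = (½ − λ) h` is
`≤ 0` at a maximum point and `≥ 0` at a minimum point of `φ` on the compact `M`, so `λ = ½`;
`R = λ m = m/2`; `φ = R + |∇φ|² ≥ m/2` everywhere, with equality at the maximum point of `φ`
where `dφ = 0`. (Eminenti–La Nave–Mantegazza 2008, §1; Carrillo–Ni 2009, Rem. 4.2: "when `f` =
constant, `(M, g)` is an Einstein manifold with `Ric_M = ½ g_M`".)
[cite: MunteanuWang2016, Thm 1.2 (p. 3); proof of Thm 5.1 (p. 21)]
[cite: CarrilloNi2009, Rem. 4.2] -/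
theorem einsteinShrinker_const_of_compactSpace [CompactSpace M] [ConnectedSpace M]
    (hg : g.IsRiemannian) {f : M → ℝ} (hf : ContMDiff I 𝓘(ℝ, ℝ) ∞ f) {lam : ℝ}
    (hRic : ∀ (x : M) (X Y : TangentSpace I x), g.ricci x X Y = lam * g.val x X Y)
    (hsol : ∀ (x : M) (X Y : TangentSpace I x),
      g.ricci x X Y + g.hessian f x X Y = (1 / 2 : ℝ) * g.val x X Y)
    (hnorm : ∀ x : M, g.scalarCurvature x + g.gradSq f x = f x)
    (hm : 0 < finrank ℝ E) :
    lam = 1 / 2 ∧ (∀ x : M, g.scalarCurvature x = (finrank ℝ E : ℝ) / 2) ∧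
      ∀ x : M, f x = (finrank ℝ E : ℝ) / 2 := by
  haveI : Nontrivial E := Module.nontrivial_of_finrank_pos hm
  have hcont : Continuous f := hf.continuous
  have hf2 : ∀ x, ContMDiffAt I 𝓘(ℝ, ℝ) 2 f x := fun x ↦
    (hf.of_le (WithTop.coe_le_coe.2 le_top)).contMDiffAt
  obtain ⟨x₀⟩ : Nonempty M := inferInstance
  -- a maximum and a minimum point of `f`
  obtain ⟨xmax, -, hmax⟩ := isCompact_univ.exists_isMaxOn (univ_nonempty) hcont.continuousOn
  obtain ⟨xmin, -, hmin⟩ := isCompact_univ.exists_isMinOn (univ_nonempty) hcont.continuousOn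
  have hHess := hessian_eq_of_einsteinShrinker g hRic hsol
  -- a nonzero tangent vector at any point
  have hv : ∀ x : M, ∃ v : TangentSpace I x, v ≠ 0 := fun x ↦ exists_ne (0 : E)
  -- `½ − λ ≤ 0` at the maximum
  have hle : 1 / 2 - lam ≤ 0 := by
    obtain ⟨v, hv0⟩ := hv xmax
    have h1 := g.hessian_apply_self_nonpos_of_isLocalMax (hf2 xmax) (hmax.isLocalMax univ_mem) v
    rw [hHess] at h1
    have hpos : 0 < g.val xmax v v := hg xmax v hv0
    by_contra hcon
    push Not at hcon
    have : 0 < (1 / 2 - lam) * g.val xmax v v := mul_pos hcon hpos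
    linarith
  -- `½ − λ ≥ 0` at the minimum
  have hge : 0 ≤ 1 / 2 - lam := by
    obtain ⟨v, hv0⟩ := hv xmin
    have h1 := g.hessian_apply_self_nonneg_of_isLocalMin (hf2 xmin) (hmin.isLocalMin univ_mem) v
    rw [hHess] at h1
    have hpos : 0 < g.val xmin v v := hg xmin v hv0
    by_contra hcon
    push Not at hcon
    have : (1 / 2 - lam) * g.val xmin v v < 0 := mul_neg_of_neg_of_pos hcon hpos
    linarith
  have hlam : lam = 1 / 2 := by linarith
  -- the scalar curvature
  have hR : ∀ x : M, g.scalarCurvature x = (finrank ℝ E : ℝ) / 2 := fun x ↦ by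
    rw [scalarCurvature_eq_of_ricci_eq_smul g hRic x, hlam]
    ring
  refine ⟨hlam, hR, ?_⟩
  -- the potential: `f ≥ m/2` everywhere, `f(xmax) = m/2`
  have hfge : ∀ x : M, (finrank ℝ E : ℝ) / 2 ≤ f x := fun x ↦ by
    have h := hnorm x
    rw [hR x] at h
    have hnn : 0 ≤ g.gradSq f x := g.gradSq_nonneg hg f x
    linarith
  have hfmax : f xmax = (finrank ℝ E : ℝ) / 2 := by
    have hd : mvfderiv I f xmax = 0 := mvfderiv_eq_zero_of_isMaxOn hmax
    have h0 : g.gradSq f xmax = 0 := g.gradSq_eq_zero_of_mvfderiv_eq_zero hd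
    have h := hnorm xmax
    rw [h0, add_zero, hR xmax] at h
    exact h.symm
  intro x
  exact le_antisymm ((hmax (mem_univ x)).trans hfmax.le) (hfge x)

end Einstein

/-! ### Dimension three: constant curvature `K` forces `K = ¼`, `R ≡ φ ≡ 3/2` -/

section Three

open scoped NNReal ENNReal
open MeasureTheory

/-- **Compact three-dimensional normalised shrinkers of constant curvature `K`: `K = ¼`,
`R ≡ 3/2`, `φ ≡ 3/2`** (derivation (a) of `threeShrinkerClassification_modelData`: "`Ric =
(2/r²) h`, so `Hess φ = (½ − 2/r²) h` … forces `r = 2` … `R = 6/r² = 3/2`, `|∇φ| = 0`, and the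
normalisation gives `φ ≡ 3/2`"). Hypotheses: the binder of the fact with `N` compact, and
constant sectional curvature `K` of `h` for its Levi-Civita connection (Ivey 1993, Thm. 1 supplies
this for every compact three-dimensional shrinking soliton). By `Ric = 2K h` (Lee 2018,
Prop. 8.36) and `einsteinShrinker_const_of_compactSpace`.
[cite: MunteanuWang2016, Thm 1.2 (p. 3); proof of Thm 5.1 (p. 21)] [cite: Ivey1993, Thm 1]
[cite: Lee2018, Prop. 8.36] -/
theorem constantCurvatureShrinker_three_of_compactSpace (N : Type*) [TopologicalSpace N]
    [ChartedSpace (EuclideanSpace ℝ (Fin 3)) N] [IsManifold (𝓡 3) ∞ N] [CompactSpace N]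
    [ConnectedSpace N]
    (h : PseudoRiemannianMetric (𝓡 3) ∞ (EuclideanSpace ℝ (Fin 3))
      (TangentSpace (𝓡 3) : N → Type _))
    [h.HasLeviCivita]
    (φ : N → ℝ) (hh : h.IsRiemannian) (hφ : ContMDiff (𝓡 3) 𝓘(ℝ, ℝ) ∞ φ)
    (hsol : ∀ (x : N) (X Y : TangentSpace (𝓡 3) x),
      h.ricci x X Y + h.hessian φ x X Y = (1 / 2 : ℝ) * h.val x X Y)
    (hnorm : ∀ x : N, h.scalarCurvature x + h.gradSq φ x = φ x)
    {K : ℝ} (hK : h.HasConstantSectionalCurvatureWith h.leviCivita K) :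
    K = 1 / 4 ∧ (∀ x : N, h.scalarCurvature x = 3 / 2) ∧ ∀ x : N, φ x = 3 / 2 := by
  have h3 : finrank ℝ (EuclideanSpace ℝ (Fin 3)) = 3 := finrank_euclideanSpace_fin
  have hRic : ∀ (x : N) (X Y : TangentSpace (𝓡 3) x), h.ricci x X Y = (2 * K) * h.val x X Y := by
    intro x X Y
    rw [ricci_apply, hK.ricci_eq_smul_of_isRiemannian hh h3 x X Y]
    norm_num
  obtain ⟨hlam, hR, hf⟩ := einsteinShrinker_const_of_compactSpace h hh hφ hRic hsol hnorm
    (by rw [h3]; norm_num)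
  rw [h3] at hR hf
  refine ⟨by linarith, fun x ↦ ?_, fun x ↦ ?_⟩
  · rw [hR x]; norm_num
  · rw [hf x]; norm_num

/-- The same for constant sectional curvature of the metric in the connection-free sense
`h.HasConstantSectionalCurvature K` (every Levi-Civita connection of `h`).
[cite: MunteanuWang2016, Thm 1.2 (p. 3)] [cite: Ivey1993, Thm 1] -/
theorem constantCurvatureShrinker_three_of_compactSpace' (N : Type*) [TopologicalSpace N]
    [ChartedSpace (EuclideanSpace ℝ (Fin 3)) N] [IsManifold (𝓡 3) ∞ N] [CompactSpace N]
    [ConnectedSpace N]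
    (h : PseudoRiemannianMetric (𝓡 3) ∞ (EuclideanSpace ℝ (Fin 3))
      (TangentSpace (𝓡 3) : N → Type _))
    [h.HasLeviCivita]
    (φ : N → ℝ) (hh : h.IsRiemannian) (hφ : ContMDiff (𝓡 3) 𝓘(ℝ, ℝ) ∞ φ)
    (hsol : ∀ (x : N) (X Y : TangentSpace (𝓡 3) x),
      h.ricci x X Y + h.hessian φ x X Y = (1 / 2 : ℝ) * h.val x X Y)
    (hnorm : ∀ x : N, h.scalarCurvature x + h.gradSq φ x = φ x)
    {K : ℝ} (hK : h.HasConstantSectionalCurvature K) :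
    K = 1 / 4 ∧ (∀ x : N, h.scalarCurvature x = 3 / 2) ∧ ∀ x : N, φ x = 3 / 2 :=
  constantCurvatureShrinker_three_of_compactSpace N h φ hh hφ hsol hnorm
    (hK.with (isLeviCivita_leviCivita_holds (g := h)))

/-- **Disjunct (a) of `threeShrinkerClassification_modelData`, potential part, from constant
curvature.** In the fact's binder with `N` compact and `h` of constant sectional curvature `K`:
`CompactSpace N ∧ (∀ x, R = 3/2) ∧ (∀ x, φ = 3/2)` — the first three clauses of disjunct (a); the
remaining volume clause `Vol(N) = 16π²/k` is the Killing–Hopf quotient `S³(2)/Γ`, `|Γ| = k`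
(`KillingHopf.exists_orthogonal_quotient`) together with `Vol(S³(2)) = 16π²`, not proved here.
[cite: MunteanuWang2016, Thm 1.2 (p. 3); proof of Thm 5.1 (p. 21)] [cite: Ivey1993, Thm 1] -/
theorem modelData_a_potential_of_constantCurvature (N : Type*) [TopologicalSpace N]
    [ChartedSpace (EuclideanSpace ℝ (Fin 3)) N] [IsManifold (𝓡 3) ∞ N] [CompactSpace N]
    [ConnectedSpace N]
    (h : PseudoRiemannianMetric (𝓡 3) ∞ (EuclideanSpace ℝ (Fin 3))
      (TangentSpace (𝓡 3) : N → Type _))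
    [h.HasLeviCivita]
    (φ : N → ℝ) (hh : h.IsRiemannian) (hφ : ContMDiff (𝓡 3) 𝓘(ℝ, ℝ) ∞ φ)
    (hsol : ∀ (x : N) (X Y : TangentSpace (𝓡 3) x),
      h.ricci x X Y + h.hessian φ x X Y = (1 / 2 : ℝ) * h.val x X Y)
    (hnorm : ∀ x : N, h.scalarCurvature x + h.gradSq φ x = φ x)
    {K : ℝ} (hK : h.HasConstantSectionalCurvature K) :
    CompactSpace N ∧ (∀ x : N, h.scalarCurvature x = 3 / 2) ∧ (∀ x : N, φ x = 3 / 2) := by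
  obtain ⟨-, hR, hf⟩ := constantCurvatureShrinker_three_of_compactSpace' N h φ hh hφ hsol hnorm hK
  exact ⟨inferInstance, hR, hf⟩

end Three

end Literature.Geometry.Riemannian

end
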